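import Summits.ResolutionOfSingularities.ResolutionOfSingularities.Theorems.PurelyInseparableDim4ChartCentreClosed
import HarnessLib

/-!
# Purely inseparable four-folds `z^p + F(x₁, …, x₄)`: the GLOBAL CENTRE of a coordinate subspace seen through a
# ZIGZAG chart `Z ← Y → 𝔸⁵` (brick (c) 3a of cell `res-dim4-pi`, typ-2 g3 for the joint point∘coordinate chains)

[OURS · counted 0] (D-0157 DOOR 2; director-resolution DR-157-C; desk WORD #66 (4)(c) / #70 (c); frame
`PIDim4.TerminationImpliesOrderReduction`, S3 (c); interface asked for BY SIGNATURE by typ-3 g3, bus 22:03:08Z).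
typ-2 g2's `PurelyInseparableDim4ChartCentreClosed.lean` §4 packaged the global centre `𝓘(closure φ(V(x_Λ')))` of a
coordinate subspace seen in a FULL chart `φ : 𝔸⁵_K ⟶ Z`. In typ-3's configurations a point may have been blown up
inside `φ(𝔸⁵)` away from the coordinate centre, after which the chart is only a ZIGZAG `Z ←φ— Y —ψ→ 𝔸⁵_K` (two open
immersions; `Y` an open piece of `𝔸⁵` still containing the whole centre). This file is the same package in that
dress. With `C := ψ^* 𝓘Λ = (𝓘Λ 4 K Λ').comap ψ` (the centre on `Y`) and `Zc := 𝓘(closure φ(V(C)))` (the global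
centre on `Z`), PROVED here (no `sorry`, no new axiom):

* `radical_comap_𝓘Λ` — `C` is radical (pull-back of a radical ideal sheaf along an open immersion);
* `comap_globalCentre_zigzag` — `φ^* Zc = C` (no closedness needed);
* `coe_support_globalCentre_zigzag` — if `φ(ψ⁻¹ V(x_Λ'))` is closed in `Z`, `V(Zc) = φ(ψ⁻¹ V(x_Λ'))`;
* `isRegular_globalCentre_zigzag` — then `Zc` is a regular centre (BGMW Def. 3.1.3: `V(C)` is an open subscheme of
  the affine space `V(x_Λ')`);
* `hasSNCWith_globalCentre_zigzag` — an snc boundary `E` on `Z` whose restriction `φ^*E` has snc with `C` has snc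
  with `Zc` (BGMW Def. 3.1.3 (2));
* `support_globalCentre_zigzag_subset_support` — if a marked ideal `M` of multiplicity `p` reads
  `φ^* M = ψ^*((z^p + F')·𝒪)` and `p ≤ ord_{(x_{S'})} F'`, then `V(Zc) ⊆ supp M` (BGMW Def. 3.1.3 (1));
* **`globalCentre_zigzag_package`** — the five facts bundled, the hypothesis list typ-3 g3 asked for (their
  `hsee : V(x_Λ') ⊆ ψ(Y)` is not needed by any conjunct and is left to the caller's invariant).

All proofs are the tree's open-immersion devices (`comap_vanishingIdeal_closureImage_support`,
`isRegular_subscheme_vanishingIdeal_closureImage`, `HasSNC.hasSNCWith_vanishingIdeal_closureImage`,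
`radical_comap_of_smooth`, `Scheme.IsRegular.of_isOpenImmersion`) applied to `j = φ`, `C = ψ^* 𝓘Λ`. Nothing here
is a statement about resolution of singularities in dimension ≥ 4 / characteristic `p` (NOT proved anywhere in
this programme). bears_on: LADDER-RESOLUTION:D157-DOOR2 (res-dim4-pi). Supports stmt-ResolutionOfSingularities-16155
(helper, (c) 3a).
-/

-- every declaration of this summit lives under `Summit.ResolutionOfSingularities.ResolutionOfSingularities`
-- (summit = problem), which the duplicate-namespace linter flags; house convention (cf. the Target file).
set_option linter.dupNamespace false

noncomputable section

open MvPolynomial Finset CategoryTheory CategoryTheory.Limits AlgebraicGeometry Opposite TopologicalSpace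
open AlgebraicGeometry.Scheme.IdealSheafData (ofIdealTop vanishingIdeal)

namespace Summit.ResolutionOfSingularities.ResolutionOfSingularities.Theorems.PIDim4

open Literature.AlgebraicGeometry.Resolution
open Literature.AlgebraicGeometry.Resolution.AffinePointBlowup (P A γ coord Wtop)

namespace ChartDictionary

section Zigzag

variable {K : Type} [Field K] {Z Y : Scheme.{0}} (φ : Y ⟶ Z) [IsOpenImmersion φ] (ψ : Y ⟶ P 4 K)
  [IsOpenImmersion ψ]

omit [IsOpenImmersion φ] in
/-- The centre on the zigzag piece, `C = ψ^* 𝓘Λ`, is a radical ideal sheaf. -/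
theorem radical_comap_𝓘Λ (Λ' : Set (Fin (4 + 1))) :
    ((AffineCoordBlowup.𝓘Λ 4 K Λ').comap ψ).radical = (AffineCoordBlowup.𝓘Λ 4 K Λ').comap ψ :=
  radical_comap_of_smooth ψ (radical_𝓘Λ Λ')

omit [IsOpenImmersion φ] [IsOpenImmersion ψ] in
/-- The support of `C = ψ^* 𝓘Λ` is `ψ⁻¹ V(x_Λ')`. -/
theorem coe_support_comap_𝓘Λ (Λ' : Set (Fin (4 + 1))) :
    ((((AffineCoordBlowup.𝓘Λ 4 K Λ').comap ψ).support : Set Y)) =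
      ψ ⁻¹' (AffineCoordBlowup.CΛ 4 K Λ' : Set (P 4 K)) := by
  rw [Scheme.IdealSheafData.support_comap, AffineCoordBlowup.support_𝓘Λ]
  rfl

/-- **The global centre restricts to the centre on the zigzag piece**: `φ^* 𝓘(closure φ(V(C))) = C`. -/
theorem comap_globalCentre_zigzag (Λ' : Set (Fin (4 + 1))) :
    (vanishingIdeal (closureImage φ ((((AffineCoordBlowup.𝓘Λ 4 K Λ').comap ψ).support : Set Y)))).comap φ =
      (AffineCoordBlowup.𝓘Λ 4 K Λ').comap ψ :=
  comap_vanishingIdeal_closureImage_support φ (radical_comap_𝓘Λ ψ Λ')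

omit [IsOpenImmersion φ] [IsOpenImmersion ψ] in
/-- **The support of the global centre** is `φ(ψ⁻¹ V(x_Λ'))` as soon as that set is closed in `Z`. -/
theorem coe_support_globalCentre_zigzag {Λ' : Set (Fin (4 + 1))}
    (hT : IsClosed (φ '' (ψ ⁻¹' (AffineCoordBlowup.CΛ 4 K Λ' : Set (P 4 K))))) :
    ((vanishingIdeal (closureImage φ ((((AffineCoordBlowup.𝓘Λ 4 K Λ').comap ψ).support : Set Y)))).support :
        Set Z) =
      φ '' (ψ ⁻¹' (AffineCoordBlowup.CΛ 4 K Λ' : Set (P 4 K))) := by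
  rw [Scheme.IdealSheafData.coe_support_vanishingIdeal, coe_closureImage, coe_support_comap_𝓘Λ ψ, hT.closure_eq]

omit [IsOpenImmersion φ] [IsOpenImmersion ψ] in
/-- The centre on the zigzag piece lies over its image. -/
theorem support_comap_𝓘Λ_subset_preimage_image (Λ' : Set (Fin (4 + 1))) :
    ((((AffineCoordBlowup.𝓘Λ 4 K Λ').comap ψ).support : Set Y)) ⊆
      φ ⁻¹' (φ '' (ψ ⁻¹' (AffineCoordBlowup.CΛ 4 K Λ' : Set (P 4 K)))) := by
  rw [coe_support_comap_𝓘Λ ψ]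
  exact fun y hy => ⟨y, hy, rfl⟩

omit [IsOpenImmersion φ] in
/-- **The centre on the zigzag piece is a regular scheme**: `V(ψ^* 𝓘Λ)` is an open subscheme of the affine space
`V(x_Λ')`. -/
theorem isRegular_subscheme_comap_𝓘Λ (Λ' : Set (Fin (4 + 1))) :
    Scheme.IsRegular ((AffineCoordBlowup.𝓘Λ 4 K Λ').comap ψ).subscheme :=
  Scheme.IsRegular.of_isOpenImmersion
    (((AffineCoordBlowup.𝓘Λ 4 K Λ').comapIso ψ).hom ≫ pullback.snd ψ (AffineCoordBlowup.𝓘Λ 4 K Λ').subschemeι)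
    (Literature.AlgebraicGeometry.Hironaka2017.Lib.AffineCoordBlowupLSB.isRegular_CΛ 4 K Λ')

/-- **BGMW Def. 3.1.3, regularity of the global centre** seen through a zigzag chart. -/
theorem isRegular_globalCentre_zigzag [IsLocallyNoetherian Z] {Λ' : Set (Fin (4 + 1))}
    (hT : IsClosed (φ '' (ψ ⁻¹' (AffineCoordBlowup.CΛ 4 K Λ' : Set (P 4 K))))) :
    Scheme.IsRegular (vanishingIdeal (closureImage φ
      ((((AffineCoordBlowup.𝓘Λ 4 K Λ').comap ψ).support : Set Y)))).subscheme :=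
  isRegular_subscheme_vanishingIdeal_closureImage φ (isRegular_subscheme_comap_𝓘Λ ψ Λ') hT
    (Set.image_subset_range _ _) (support_comap_𝓘Λ_subset_preimage_image φ ψ Λ')

/-- **BGMW Def. 3.1.3 (2), simple normal crossings with the boundary** through a zigzag chart: if `E` has snc on
`Z` and `φ^*E` has snc with `ψ^* 𝓘Λ`, then `E` has snc with the global centre. -/
theorem hasSNCWith_globalCentre_zigzag {Λ' : Set (Fin (4 + 1))}
    (hT : IsClosed (φ '' (ψ ⁻¹' (AffineCoordBlowup.CΛ 4 K Λ' : Set (P 4 K))))) {E : List Z.IdealSheafData}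
    (hE : HasSNC E) (hEc : HasSNCWith (E.map (·.comap φ)) ((AffineCoordBlowup.𝓘Λ 4 K Λ').comap ψ)) :
    HasSNCWith E (vanishingIdeal (closureImage φ ((((AffineCoordBlowup.𝓘Λ 4 K Λ').comap ψ).support : Set Y)))) :=
  HasSNC.hasSNCWith_vanishingIdeal_closureImage φ hE (radical_comap_𝓘Λ ψ Λ') hEc hT (Set.image_subset_range _ _)
    (support_comap_𝓘Λ_subset_preimage_image φ ψ Λ')

/-- **BGMW Def. 3.1.3 (1), the centre lies in the support** through a zigzag chart: if `M` of multiplicity `p`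
reads `φ^* M = ψ^*((z^p + F')·𝒪)` and `p ≤ ord_{(x_{S'})} F'`, then `V(Zc) ⊆ supp M`. -/
theorem support_globalCentre_zigzag_subset_support [IsLocallyNoetherian Z] {S' : Finset (Fin 4)}
    (hT : IsClosed (φ '' (ψ ⁻¹'
      (AffineCoordBlowup.CΛ 4 K (insert 0 (Fin.succ '' (S' : Set (Fin 4)))) : Set (P 4 K)))))
    {p : ℕ} {M : MarkedIdeal Z} (hmult : M.mult = p) {F' : MvPolynomial (Fin 4) K}
    (hM : M.ideal.comap φ = (hypSheaf p F').comap ψ) (hperm : (p : ℕ∞) ≤ CentreBlowup.ordAlong S' F') :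
    ((vanishingIdeal (closureImage φ ((((AffineCoordBlowup.𝓘Λ 4 K
        (insert 0 (Fin.succ '' (S' : Set (Fin 4))))).comap ψ).support : Set Y)))).support : Set Z) ⊆ M.support := by
  rw [coe_support_globalCentre_zigzag φ ψ hT]
  rintro _ ⟨y, hy, rfl⟩
  change (M.mult : ℕ∞) ≤ idealOrder M.ideal _
  rw [hmult, ← idealOrder_comap_of_isOpenImmersion φ M.ideal y, hM, idealOrder_comap_of_isOpenImmersion ψ _ y]
  exact le_idealOrder_hypSheaf_of_mem_CΛ p S' F' hperm hy

/-- **THE ZIGZAG PACKAGE (BGMW Def. 3.1.3 (1)–(2) for a coordinate centre seen through `Z ← Y → 𝔸⁵`).** For open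
immersions `φ : Y ⟶ Z`, `ψ : Y ⟶ 𝔸⁵_K` and a set of coordinates `Λ'` with `φ(ψ⁻¹ V(x_Λ'))` closed in `Z`: the
global centre `Zc := 𝓘(closure φ(V(ψ^* 𝓘Λ)))` restricts to `ψ^* 𝓘Λ` on `Y`, is supported on `φ(ψ⁻¹ V(x_Λ'))`, is
regular, has simple normal crossings with every snc boundary whose restriction to `Y` has snc with `ψ^* 𝓘Λ`, and
lies in the support of every marked ideal of multiplicity `p` reading `ψ^*((z^p + F')·𝒪)` on `Y` with
`p ≤ ord_{(x_{S'})} F'` (`Λ' = {z} ∪ x_{S'}`). -/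
theorem globalCentre_zigzag_package [IsLocallyNoetherian Z] (Λ' : Set (Fin (4 + 1)))
    (hT : IsClosed (φ '' (ψ ⁻¹' (AffineCoordBlowup.CΛ 4 K Λ' : Set (P 4 K))))) :
    (vanishingIdeal (closureImage φ ((((AffineCoordBlowup.𝓘Λ 4 K Λ').comap ψ).support : Set Y)))).comap φ =
        (AffineCoordBlowup.𝓘Λ 4 K Λ').comap ψ ∧
      ((vanishingIdeal (closureImage φ ((((AffineCoordBlowup.𝓘Λ 4 K Λ').comap ψ).support : Set Y)))).support :
          Set Z) = φ '' (ψ ⁻¹' (AffineCoordBlowup.CΛ 4 K Λ' : Set (P 4 K))) ∧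
      Scheme.IsRegular (vanishingIdeal (closureImage φ
        ((((AffineCoordBlowup.𝓘Λ 4 K Λ').comap ψ).support : Set Y)))).subscheme ∧
      (∀ E : List Z.IdealSheafData, HasSNC E →
        HasSNCWith (E.map (·.comap φ)) ((AffineCoordBlowup.𝓘Λ 4 K Λ').comap ψ) →
          HasSNCWith E (vanishingIdeal (closureImage φ
            ((((AffineCoordBlowup.𝓘Λ 4 K Λ').comap ψ).support : Set Y))))) ∧
      (∀ (p : ℕ) (M : MarkedIdeal Z) (F' : MvPolynomial (Fin 4) K) (S' : Finset (Fin 4)),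
        Λ' = insert 0 (Fin.succ '' (S' : Set (Fin 4))) → M.mult = p → M.ideal.comap φ = (hypSheaf p F').comap ψ →
          (p : ℕ∞) ≤ CentreBlowup.ordAlong S' F' →
            ((vanishingIdeal (closureImage φ
              ((((AffineCoordBlowup.𝓘Λ 4 K Λ').comap ψ).support : Set Y)))).support : Set Z) ⊆ M.support) := by
  refine ⟨comap_globalCentre_zigzag φ ψ Λ', coe_support_globalCentre_zigzag φ ψ hT,
    isRegular_globalCentre_zigzag φ ψ hT, fun E hE hEc => hasSNCWith_globalCentre_zigzag φ ψ hT hE hEc,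
    fun p M F' S' hΛ hmult hM hperm => ?_⟩
  subst hΛ
  exact support_globalCentre_zigzag_subset_support φ ψ hT hmult hM hperm

end Zigzag

end ChartDictionary

end Summit.ResolutionOfSingularities.ResolutionOfSingularities.Theorems.PIDim4

end
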